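import Summits.NavierStokesRegularity.NavierStokesRegularity.Theorems.OddMorawetzLocal.Negative.OddMorawetzLocalRefutationDefsV
import Summits.NavierStokesRegularity.NavierStokesRegularity.Theorems.OddMorawetzOddMorawetzLocalNormFSemantics
import Summits.NavierStokesRegularity.NavierStokesRegularity.Theorems.OddMorawetzOddMorawetzLocalActFunctorial
import HarnessLib

/-!
# The isotropic basis in orbit coordinates: kernel of the derivation matrix and reconstruction (stub `iso_transfer`)

Crux `OddMorawetzLocal` (item stmt-NavierStokesRegularity-1376), refutation skeleton (lead c1), registered stub
`iso_transfer`.  Pure list algebra over Mathlib on the computable jet polynomials `JPoly R = List (R × List JVar)`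
(`OddMorawetzLocal/Negative/OddMorawetzLocalJetAlgebra.lean`, `…RefutationDefs*.lean`); no named facts, no new
definitions.  Reuses the landed `JPoly.coeffOf_normF` / `JPoly.normF_canonical` (`…NormFSemantics`),
`coeffOf_append` / `coeffOf_smul` / `coeffOf_cons` / `CoeffSemantics.coeffOf_nil` / `CoeffSemantics.coeffOf_cons'`
(`…CoeffSemantics`), `coeffOf_derP` (`…ActFunctorial`) and `sortVars_sortVars` (`…IdxCompleteSort`).

The rank-certificate lemma `kernel_eq_span_of_modular_certificate` pins an `O(3)`-fixed coefficient vector, written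
in the orbit coordinates `c : Fin reps.length → ℝ` of the normalised orbit sums `orbitSumN (reps[r])`, to the span of
the isotropic basis vectors `S_l = sVecD reps iso d l` (the coefficients of the iso polynomial `isoPolyF iso[l]` at the
representatives), PROVIDED every `S_l` lies in the kernel of the integer matrix `aMatrix k reps` of the derivation
`der lieZ` (part 1); afterwards the assembly converts `c = Σ γ_l S_l` back into basis coefficients using
`Σ_r S_l r · vecOf (orbitSumN reps[r]) = vecOf (isoPolyF iso[l])` (part 2).  Both parts are read off the two Boolean
kernel checks certified for every descriptor:

* `orbitReconF reps q = true`, i.e. `normF q = normF Q'` with `Q' = reps.flatMap (m ↦ coeffOf q m • orbitSumN m)`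
  (zero coefficients skipped).  Both `q = isoPolyF _` (a `normF` output, `normF_canonical`) and `Q'` (monomials of
  orbit sums are `sortVars`-values: `sortVars_of_mem_norm`) have sorted monomials, so `coeffOf_normF` transfers
  EVERY coefficient: `coeffOf q μ = coeffOf Q' μ = Σ_r coeffOf q reps[r] · coeffOf (orbitSumN reps[r]) μ`
  (`kernel_checks`, second part) — this is part 2 at the basis monomials `μ = idx k [i]`.
* `derKillsF lieZ q = true`, i.e. `normF (derP lieZ q) = []`, whence every coefficient of `der lieZ q` vanishes
  (`coeffOf_derP`, `coeffOf_normF`; the output monomials of `derP` are `sortVars`-values).  The derivation is linear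
  at the level of coefficient functions: `coeffOf (der L p) μ = Σ_{m ∈ S} coeffOf p m · coeffOf (der L [(1, m)]) μ`
  for any finite set `S` of monomials containing those of `p` (`coeffOf_der_eq_sum`), so entry `i` of
  `aMatrix k reps *ᵥ S_l`, namely `Σ_r coeffOf (derP lieZ (orbitSumN reps[r])) μ · coeffOf q reps[r]`, regroups
  through the common monomial set of `q` and the orbit sums into `coeffOf (der lieZ q) μ = 0` (`kernel_entry`).
-/

noncomputable section

set_option linter.dupNamespace false
set_option autoImplicit false

namespace Summit.NavierStokesRegularity.NavierStokesRegularity.Theorems.OddMorawetz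

open CoeffSemantics

namespace IsoTransfer

variable {R : Type} [CommRing R]

/-! ### `coeffOf` through `flatMap`, scaling, and list positions -/

-- adapted from `…OddMorawetzOddMorawetzLocalActFunctorial` (private there)
/-- `coeffOf` of a `flatMap` is the sum of the `coeffOf`s. -/
theorem coeffOf_flatMap {α : Type} (l : List α) (F : α → JPoly R) (m : List JVar) :
    JPoly.coeffOf (l.flatMap F) m = (l.map fun x => JPoly.coeffOf (F x) m).sum := by
  induction l with
  | nil => simp [JPoly.coeffOf]
  | cons x l ih => simp only [List.flatMap_cons, coeffOf_append, ih, List.map_cons, List.sum_cons]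

-- adapted from `…OddMorawetzOddMorawetzLocalActFunctorial` (private there)
/-- `coeffOf` of a polynomial with all coefficients scaled by `c` is `c *` the coefficient. -/
theorem coeffOf_map_scale (c : R) (q : JPoly R) (m : List JVar) :
    JPoly.coeffOf (q.map fun t => (c * t.1, t.2)) m = c * JPoly.coeffOf q m := by
  induction q with
  | nil => simp [JPoly.coeffOf]
  | cons t q ih =>
    simp only [List.map_cons, coeffOf_cons', ih]
    split_ifs <;> ring

/-- A sum over the entries of a list is the sum over its positions. -/
theorem sum_map_eq_sum_get {M : Type} [AddCommMonoid M] {α : Type} (l : List α) (g : α → M) :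
    (l.map g).sum = ∑ r : Fin l.length, g (l.get r) := by
  rw [← List.ofFn_getElem_eq_map, List.sum_ofFn]
  simp only [List.get_eq_getElem]

/-! ### Monomials of normal forms and orbit sums are sorted -/

/-- Every monomial of `insertTerm c m q` is `m` or a monomial of `q`. -/
theorem snd_mem_insertTerm {R : Type} [Add R] (c : R) (m : List JVar) :
    ∀ (q : JPoly R) (t : R × List JVar), t ∈ JPoly.insertTerm c m q → t.2 = m ∨ ∃ u ∈ q, t.2 = u.2
  | [], t, ht => by
    left
    simp only [JPoly.insertTerm, List.mem_singleton] at ht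
    rw [ht]
  | (c', m') :: rest, t, ht => by
    cases hc : monoCmp m m' with
    | lt =>
      simp only [JPoly.insertTerm, hc, List.mem_cons] at ht
      rcases ht with rfl | rfl | h
      · exact Or.inl rfl
      · exact Or.inr ⟨(c', m'), List.mem_cons_self, rfl⟩
      · exact Or.inr ⟨t, List.mem_cons_of_mem _ h, rfl⟩
    | eq =>
      simp only [JPoly.insertTerm, hc, List.mem_cons] at ht
      rcases ht with rfl | h
      · exact Or.inr ⟨(c', m'), List.mem_cons_self, rfl⟩
      · exact Or.inr ⟨t, List.mem_cons_of_mem _ h, rfl⟩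
    | gt =>
      simp only [JPoly.insertTerm, hc, List.mem_cons] at ht
      rcases ht with rfl | h
      · exact Or.inr ⟨(c', m'), List.mem_cons_self, rfl⟩
      · rcases snd_mem_insertTerm c m rest t h with h' | ⟨u, hu, h'⟩
        · exact Or.inl h'
        · exact Or.inr ⟨u, List.mem_cons_of_mem _ hu, h'⟩

/-- The monomials of a collected polynomial are sorted (`collect` inserts `sortVars`-values only). -/
theorem sortVars_of_mem_collect {R : Type} [Add R] :
    ∀ (p : JPoly R), ∀ t ∈ JPoly.collect p, sortVars t.2 = t.2
  | [], t, ht => by simp [JPoly.collect] at ht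
  | s :: p, t, ht => by
    change t ∈ JPoly.insertTerm s.1 (sortVars s.2) (JPoly.collect p) at ht
    rcases snd_mem_insertTerm _ _ _ t ht with h | ⟨u, hu, h⟩
    · rw [h, sortVars_sortVars]
    · rw [h]
      exact sortVars_of_mem_collect p u hu

/-- The monomials of a normal form `JPoly.norm p` are sorted. -/
theorem sortVars_of_mem_norm {R : Type} [Add R] [Zero R] [DecidableEq R] (p : JPoly R) :
    ∀ t ∈ JPoly.norm p, sortVars t.2 = t.2 := fun t ht => by
  unfold JPoly.norm at ht
  exact sortVars_of_mem_collect p t (List.mem_filter.1 ht).1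

/-- The monomials of a normalised orbit sum are sorted (`orbitSum` is a `norm` output). -/
theorem sortVars_of_mem_orbitSumN (m : List JVar) : ∀ t ∈ orbitSumN m, sortVars t.2 = t.2 := by
  intro t ht
  unfold orbitSumN at ht
  obtain ⟨u, hu, rfl⟩ := List.mem_map.1 ht
  unfold orbitSum at hu
  exact sortVars_of_mem_norm _ u hu

/-- The monomials of the orbit expansion `reps.flatMap (m ↦ c m • orbitSumN m)` (zero coefficients skipped) are
sorted. -/
theorem sortVars_of_mem_orbitExpansion (reps : List (List JVar)) (c : List JVar → ℤ) :
    ∀ t ∈ reps.flatMap (fun m => if c m = 0 then [] else JPoly.smul (c m) (orbitSumN m)), sortVars t.2 = t.2 := by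
  intro t ht
  obtain ⟨m, -, hm⟩ := List.mem_flatMap.1 ht
  split_ifs at hm with h
  · simp at hm
  · obtain ⟨u, hu, rfl⟩ := List.mem_map.1 hm
    exact sortVars_of_mem_orbitSumN m u hu

/-- The monomials of every iso polynomial `isoPolyF q` are sorted (each is a `normF` output). -/
theorem sortVars_of_mem_isoPolyF (q : IsoDesc) : ∀ t ∈ isoPolyF q, sortVars t.2 = t.2 := by
  cases q <;> exact fun t ht => (JPoly.normF_canonical _ t ht).1

/-! ### The derivation at the level of coefficient functions -/

/-- `der` on a cons: the head term and the tail contribute separately. -/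
theorem der_cons (L : Matrix (Fin 3) (Fin 3) R) (t : R × List JVar) (p : JPoly R) :
    JPoly.der L (t :: p) = JPoly.der L [t] ++ JPoly.der L p := by
  simp only [JPoly.der, List.flatMap_cons, List.flatMap_nil, List.append_nil]

/-- `der` on a single term is homogeneous in its coefficient. -/
theorem der_single_scale (L : Matrix (Fin 3) (Fin 3) R) (c : R) (m : List JVar) :
    JPoly.der L [(c, m)] = (JPoly.der L [(1, m)]).map fun u => (c * u.1, u.2) := by
  simp only [JPoly.der, List.flatMap_cons, List.flatMap_nil, List.append_nil, List.map_flatMap, List.map_map,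
    Function.comp_def, one_mul]

/-- **Key regrouping.**  The coefficients of `der L p` depend on `p` only through its coefficient function: for any
finite set `S` of monomials containing those of `p`,
`coeffOf (der L p) μ = Σ_{m ∈ S} coeffOf p m · coeffOf (der L [(1, m)]) μ`. -/
theorem coeffOf_der_eq_sum (L : Matrix (Fin 3) (Fin 3) R) (μ : List JVar) (S : Finset (List JVar)) :
    ∀ p : JPoly R, (∀ t ∈ p, t.2 ∈ S) →
      JPoly.coeffOf (JPoly.der L p) μ = ∑ m ∈ S, JPoly.coeffOf p m * JPoly.coeffOf (JPoly.der L [(1, m)]) μ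
  | [], _ => by simp [JPoly.der, coeffOf_nil]
  | (c, m₀) :: p, hS => by
    have h₀ : m₀ ∈ S := hS (c, m₀) List.mem_cons_self
    rw [der_cons, coeffOf_append, der_single_scale, coeffOf_map_scale,
      coeffOf_der_eq_sum L μ S p fun u hu => hS u (List.mem_cons_of_mem _ hu)]
    simp only [coeffOf_cons, add_mul, Finset.sum_add_distrib, ite_mul, zero_mul, Finset.sum_ite_eq', if_pos h₀]

/-! ### The two kernel checks, unfolded -/

/-- **The kernel checks at the level of coefficients.**  For a polynomial `q` with sorted monomials,
`derKillsF lieZ q` makes every coefficient of `der lieZ q` vanish, and `orbitReconF reps q` expands every coefficient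
of `q` along the normalised orbit sums of the representatives:
`coeffOf q μ = Σ_r coeffOf q reps[r] · coeffOf (orbitSumN reps[r]) μ`. -/
theorem kernel_checks (reps : List (List JVar)) (q : JPoly ℤ) (hqs : ∀ t ∈ q, sortVars t.2 = t.2)
    (h₁ : derKillsF lieZ q = true) (h₂ : orbitReconF reps q = true) :
    (∀ μ, JPoly.coeffOf (JPoly.der lieZ q) μ = 0) ∧
    (∀ μ, JPoly.coeffOf q μ =
      ∑ r : Fin reps.length, JPoly.coeffOf q (reps.get r) * JPoly.coeffOf (orbitSumN (reps.get r)) μ) := by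
  refine ⟨fun μ => ?_, fun μ => ?_⟩
  · unfold derKillsF JPoly.isZeroF at h₁
    have h := List.isEmpty_iff.1 h₁
    have hs : ∀ t ∈ JPoly.derP lieZ q, sortVars t.2 = t.2 := by
      intro t ht
      unfold JPoly.derP at ht
      obtain ⟨u, -, hu⟩ := List.mem_flatMap.1 ht
      obtain ⟨s, -, hs⟩ := List.mem_flatMap.1 hu
      obtain ⟨cw, -, rfl⟩ := List.mem_map.1 hs
      exact sortVars_sortVars _
    rw [← coeffOf_derP, ← JPoly.coeffOf_normF _ hs μ, h, coeffOf_nil]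
  · unfold orbitReconF at h₂
    have h : JPoly.normF q = JPoly.normF (reps.flatMap fun m =>
        if JPoly.coeffOf q m = 0 then [] else JPoly.smul (JPoly.coeffOf q m) (orbitSumN m)) :=
      of_decide_eq_true h₂
    rw [← JPoly.coeffOf_normF q hqs μ, h,
      JPoly.coeffOf_normF _ (sortVars_of_mem_orbitExpansion reps (JPoly.coeffOf q)) μ, coeffOf_flatMap,
      sum_map_eq_sum_get]
    refine Finset.sum_congr rfl fun r _ => ?_
    split_ifs with hc
    · rw [hc, zero_mul, coeffOf_nil]
    · exact coeffOf_smul _ _ _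

/-- **One entry of `aMatrix k reps *ᵥ S`.**  If every coefficient of `der lieZ q` vanishes and `q` expands along the
normalised orbit sums with coefficients `coeffOf q reps[r]`, then
`Σ_r coeffOf (derP lieZ (orbitSumN reps[r])) μ · coeffOf q reps[r] = 0` for every monomial `μ`. -/
theorem kernel_entry (reps : List (List JVar)) (q : JPoly ℤ)
    (h0 : ∀ μ, JPoly.coeffOf (JPoly.der lieZ q) μ = 0)
    (hexp : ∀ μ, JPoly.coeffOf q μ =
      ∑ r : Fin reps.length, JPoly.coeffOf q (reps.get r) * JPoly.coeffOf (orbitSumN (reps.get r)) μ)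
    (μ : List JVar) :
    ∑ r : Fin reps.length,
      JPoly.coeffOf (JPoly.derP lieZ (orbitSumN (reps.get r))) μ * JPoly.coeffOf q (reps.get r) = 0 := by
  classical
  let S : Finset (List JVar) := ((q ++ reps.flatMap orbitSumN).map Prod.snd).toFinset
  have hqS : ∀ t ∈ q, t.2 ∈ S := fun t ht =>
    List.mem_toFinset.2 (List.mem_map.2 ⟨t, List.mem_append_left _ ht, rfl⟩)
  have hOS : ∀ (r : Fin reps.length), ∀ t ∈ orbitSumN (reps.get r), t.2 ∈ S := fun r t ht =>
    List.mem_toFinset.2 (List.mem_map.2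
      ⟨t, List.mem_append_right _ (List.mem_flatMap.2 ⟨reps.get r, List.get_mem _ _, ht⟩), rfl⟩)
  calc ∑ r : Fin reps.length,
        JPoly.coeffOf (JPoly.derP lieZ (orbitSumN (reps.get r))) μ * JPoly.coeffOf q (reps.get r)
      = ∑ r : Fin reps.length, JPoly.coeffOf q (reps.get r) *
          ∑ m ∈ S, JPoly.coeffOf (orbitSumN (reps.get r)) m * JPoly.coeffOf (JPoly.der lieZ [(1, m)]) μ :=
        Finset.sum_congr rfl fun r _ => by
          rw [coeffOf_derP, coeffOf_der_eq_sum lieZ μ S _ (hOS r), mul_comm]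
    _ = ∑ m ∈ S, (∑ r : Fin reps.length,
          JPoly.coeffOf q (reps.get r) * JPoly.coeffOf (orbitSumN (reps.get r)) m) *
            JPoly.coeffOf (JPoly.der lieZ [(1, m)]) μ := by
        simp only [Finset.mul_sum, Finset.sum_mul, mul_assoc]
        exact Finset.sum_comm
    _ = ∑ m ∈ S, JPoly.coeffOf q m * JPoly.coeffOf (JPoly.der lieZ [(1, m)]) μ :=
        Finset.sum_congr rfl fun m _ => by rw [hexp m]
    _ = JPoly.coeffOf (JPoly.der lieZ q) μ := (coeffOf_der_eq_sum lieZ μ S q hqS).symm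
    _ = 0 := h0 μ

/-! ### Entries of `aMatrix` and `sVecD` -/

/-- Entry `(i, r)` of `aMatrix k reps` (stated as a rewrite rule: unfolding `Matrix.of` by definitional unfolding
against a `coeffOf` term makes the unifier evaluate orbit sums). -/
theorem aMatrix_apply (k : ℕ) (reps : List (List JVar)) (i : Fin (idx k).length) (r : Fin reps.length) :
    aMatrix k reps i r = JPoly.coeffOf (JPoly.derP lieZ (orbitSumN (reps.get r))) ((idx k).get i) := by
  unfold aMatrix
  rw [Matrix.of_apply]

/-- Entry `r` of the isotropic basis vector `sVecD reps iso d l`. -/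
theorem sVecD_apply (reps : List (List JVar)) (iso : List IsoDesc) (d : ℕ) (l : Fin d) (r : Fin reps.length) :
    sVecD reps iso d l r = JPoly.coeffOf (isoPolyF (iso.getD l.val (.poly []))) (reps.get r) := rfl

end IsoTransfer

open IsoTransfer

/-! ### The registered stub -/

/-- **Stub `iso_transfer` of crux `OddMorawetzLocal` (refutation).**  If every descriptor of `iso` passes the kernel
checks `derKillsF lieZ` (the derivation kills the iso polynomial) and `orbitReconF reps` (the iso polynomial is the
combination of the normalised orbit sums given by its coefficients at the representatives), then (1) every isotropic
basis vector in orbit coordinates `sVecD reps iso d l` lies in the kernel of the integer derivation matrix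
`aMatrix k reps`, and (2) recombining the coefficient vectors of the normalised orbit sums with the weights
`sVecD reps iso d l` gives back the coefficient vector of the iso polynomial `isoPolyF iso[l]`. -/
theorem iso_transfer (k : ℕ) (reps : List (List JVar))
    (iso : List IsoDesc) (d : ℕ) (hd : iso.length = d)
    (hder : ∀ q ∈ iso, derKillsF lieZ (isoPolyF q) = true)
    (hrec : ∀ q ∈ iso, orbitReconF reps (isoPolyF q) = true) :
    (∀ l : Fin d, (aMatrix k reps).mulVec (sVecD reps iso d l) = 0) ∧
    (∀ (l : Fin d) (i : Fin (idx k).length),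
      (∑ r, ((sVecD reps iso d l r : ℤ) : ℝ) * ((vecOf k (orbitSumN (reps.get r)) i : ℤ) : ℝ)) =
        ((vecOf k (isoPolyF (iso.getD l.val (.poly []))) i : ℤ) : ℝ)) := by
  have hmem : ∀ l : Fin d, iso.getD l.val (.poly []) ∈ iso := fun l => by
    have hl : l.val < iso.length := l.isLt.trans_eq hd.symm
    rw [List.getD_eq_getElem _ _ hl]
    exact List.getElem_mem hl
  refine ⟨fun l => ?_, fun l i => ?_⟩
  · obtain ⟨h0, hexp⟩ :=
      kernel_checks reps _ (sortVars_of_mem_isoPolyF _) (hder _ (hmem l)) (hrec _ (hmem l))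
    funext i
    rw [Pi.zero_apply, Matrix.mulVec_apply_eq_sum]
    calc ∑ r, aMatrix k reps i r * sVecD reps iso d l r
        = ∑ r : Fin reps.length, JPoly.coeffOf (JPoly.derP lieZ (orbitSumN (reps.get r))) ((idx k).get i) *
            JPoly.coeffOf (isoPolyF (iso.getD l.val (.poly []))) (reps.get r) :=
          Finset.sum_congr rfl fun r _ => by rw [aMatrix_apply, sVecD_apply]
      _ = 0 := kernel_entry reps _ h0 hexp _
  · obtain ⟨-, hexp⟩ :=
      kernel_checks reps _ (sortVars_of_mem_isoPolyF _) (hder _ (hmem l)) (hrec _ (hmem l))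
    unfold sVecD vecOf
    have h := congrArg (Int.cast : ℤ → ℝ) (hexp ((idx k).get i))
    push_cast at h
    exact h.symm

end Summit.NavierStokesRegularity.NavierStokesRegularity.Theorems.OddMorawetz

end
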